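/-
Copyright (c) 2026. All rights reserved.
Released under Apache 2.0 license as described in the file LICENSE.
Authors: abc-iut cell, fact-proving seat abc-iut-f-074 (block F, tranche 74; FACT-LIST rows F-0326,
F-0330, F-0331, F-0333 of abc-iut-L4-t9's `BiAnabelianTelecore.lean`, exact criterion).
-/
import Literature.AnabelianGeometry.AbsoluteAnabelian.AbsTopIII.BiAnabelianStarLaxFamilyPins

/-!
# [AbsTopIII] Corollary 3.7 (iv), second incompatibility: THE EXACT CRITERION

S. Mochizuki, *Topics in absolute anabelian geometry III* [MochizukiAbsTopIII2015] (kurims manuscript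
`paper:url-5493eb38cbb7`), Cor 3.7 (iv) p. 88, second sentence: "the telecore structure `𝔗_δ` of (ii),
the family of homotopies `ℋ_δ` of (ii), and the observable `𝔖†_log` of (iii) are not simultaneously
compatible"; proof p. 88 "entirely similar" to Cor 3.6 (iv) pp. 81–82 ("two mutually contradictory
homotopies [...] a contradiction to Lemma 3.4"), Lemma 3.4 p. 74.

PROOF-ONLY companion of `BiAnabelianTelecore.lean` (abc-iut-L4-t9), whose `TelecoreIncompatibleStmt θ`
types the sentence as: NO family of homotopies on `𝒟*` contains the pinned generators of `ℋ_δ`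
(`DeltaPinned θ`), the telecore homotopy (`TelePinned`) and the `𝔖†_log` homotopies (`StarLogPinned`).
This file SETTLES that typed statement for EVERY abstract setting `𝔖 : BiAnabelianSetting X E N` and
EVERY bi-anabelian lift datum `θ^bi`:

* `iotaTimes_eq_of_pinned` — a family containing all the pinned homotopies forces, at every object `A`
  of `𝒳`, `ι_{×,A} = λ^×(ℓ_A⁻¹) ≫ ι_{log,A}` where `ℓ = logIsoId : log ≅ 𝟭` is the GIVEN isomorphism of
  Def 3.1 (iv) (the argument of abc-iut-L4-t9's reduction `telecoreIncompatibleStmt_of_obstruction`,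
  sharpened by the remark that the isomorphism `(θ^bi)⁻¹ : A ⥲ log A` it produces is `ℓ_A⁻¹`, whatever
  `θ^bi` is: `θbi_inv_app_logSq_diag`);
* conversely the lax family `starLaxFamily θ` (`BiAnabelianStarLaxCells.lean`) contains them all as
  soon as that identity holds (`BiAnabelianStarLaxFamilyPins.lean`);
* hence **`telecoreIncompatibleStmt_iff`: `TelecoreIncompatibleStmt θ ↔ ∃ A, λ^×(ℓ_A⁻¹) ≫ ι_{log,A} ≠
  ι_{×,A}`**, i.e. `ι_× ≠ (λ^× ◃ ℓ⁻¹) ≫ ι_log` as natural transformations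
  (`telecoreIncompatibleStmt_iff_ne`).  Consequences: the typed statement does NOT depend on the lift
  datum `θ^bi` (`telecoreIncompatibleStmt_iff_of_lift`); it follows from the Lemma-3.4 obstruction
  `LogKernelObstruction` (recovering t9's reduction) and already from `¬ LogCoreKernel`
  (`telecoreIncompatibleStmt_of_not_logCoreKernel`), and it FAILS exactly when `ι_×` is `ι_log`
  transported along `ℓ` (e.g. the thin setting of `BiAnabelianTelecoreSchemaNegative.lean`, every
  setting with empty `𝒳`);
* FACT-LIST instance forms (R5, named instances only): `telePinned_holds` / `deltaPinned_holds` (the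
  lax family, every setting and `θ^bi`), `starLogPinned_holds` (the lax family, every setting where
  `ι_×` is `ι_log` transported along `ℓ`); the model instances `telecoreIncompatibleStmt_holds` /
  `cor_3_7_iv_holds` are in `BiAnabelianTelecoreIncompatibilityModelHolds.lean`.

HONEST FRAMING: a theorem about the TYPED statement over abstract data; for the MLF data of print the
criterion is met via Lemma 3.4 (at the tree's model: `TFModel.model_of_telecoreIncompatibleStmt`); the
printed Cor 3.7 (iv) is neither strengthened nor weakened by this; nothing here bears on [IUTchIII]
Cor. 3.12; no side taken; typed ≠ proved except for the theorems of this file.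
-/

set_option autoImplicit false

namespace Literature.AnabelianGeometry.AbsoluteAnabelian

open CategoryTheory Quiver DiagramOfCategories

universe u

namespace AbsTopIII.BiAnabelianSetting

variable {X E N : Type u} [Category.{u} X] [Category.{u} E] [Category.{u} N]
  (𝔖 : BiAnabelianSetting X E N) (θ : FiberSquare.BiAnabelianLift 𝔖.gal)

/-! ## A family with all the pinned homotopies forces `ι_× = λ^×(ℓ⁻¹) ≫ ι_log` -/

/-- **The pinned homotopies force `ι_{×,A} = λ^×(ℓ_A⁻¹) ≫ ι_{log,A}` at every object** (`ℓ = logIsoId`):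
inside ONE family of homotopies on `𝒟*` containing `θ_{□⋎}`, `θ_⋎`, the telecore homotopy and `ι_×`,
`ι_{log,⋎}`, the two routes `[λ^×]∘[δ_□] ⇝ [λ^{×pf}]∘[pr_{⋎+1}]∘[δ_{⋎+1}]` of the proof of Cor 3.6 (iv)
p. 82 (read for `𝒟*`) have equal homotopies, whence `ι_{×,A} = λ^×((θ^bi)⁻¹) ≫ ι_{log,A}` with `(θ^bi)⁻¹`
taken at `log_𝒳(δ_𝒳 A)` — which is `ℓ_A⁻¹` for every lift datum.  (abc-iut-L4-t9's argument verbatim up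
to its last step.) [cite: MochizukiAbsTopIII2015, Cor 3.7 (iv) p.88] -/
theorem iotaTimes_eq_of_pinned (K : 𝔖.starDiagram.HomotopyFamily) (hΔ : 𝔖.DeltaPinned θ K)
    (hT : 𝔖.TelePinned K) (hSL : 𝔖.StarLogPinned K) (x₀ : X) :
    𝔖.iotaTimes.app x₀ = 𝔖.lamTimes.map (𝔖.logIsoId.inv.app x₀) ≫ 𝔖.iotaLog.app x₀ := by
  obtain ⟨hA, hG⟩ := hΔ
  obtain ⟨⟨hTm, hhTm⟩, hL⟩ := hSL
  obtain ⟨hA0, hhA0⟩ := hA 0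
  obtain ⟨hA1, hhA1⟩ := hA (0 + 1)
  obtain ⟨hG0, hhG0⟩ := hG 0
  obtain ⟨hT0, hhT0⟩ := hT 0
  obtain ⟨hL0, hhL0⟩ := hL 0
  -- the edges of `Γ⃗_{𝒟*}` that occur (`⋎ = 0`, `⋎ + 1 = 0 + 1`)
  let d0 : (Cor37Vertex.ref ⟶ Cor37Vertex.first 0) := Cor37Edge.diag.{u} 0
  let d1 : (Cor37Vertex.ref ⟶ Cor37Vertex.first (0 + 1)) := Cor37Edge.diag.{u} (0 + 1)
  let p0 : (Cor37Vertex.first 0 ⟶ Cor37Vertex.box) := Cor37Edge.pr.{u} 0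
  let p1 : (Cor37Vertex.first (0 + 1) ⟶ Cor37Vertex.box) := Cor37Edge.pr.{u} (0 + 1)
  let lg : (Cor37Vertex.first (0 + 1) ⟶ Cor37Vertex.first 0) := Cor37Edge.log.{u} (0 + 1) 0 rfl
  let lt : (Cor37Vertex.box ⟶ Cor37Vertex.space) := Cor37Edge.lamTimes.{u}
  let lp : (Cor37Vertex.box ⟶ Cor37Vertex.space) := Cor37Edge.lamTimesPf.{u}
  -- the paths from the core vertex `𝒳` to `𝒩` visited by the two routes
  let PBt : Path Cor37Vertex.ref Cor37Vertex.space := deltaBoxPath.{u}.cons lt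
  let PBp : Path Cor37Vertex.ref Cor37Vertex.space := deltaBoxPath.{u}.cons lp
  let R : Path Cor37Vertex.ref Cor37Vertex.space := (prDeltaPath.{u} (0 + 1)).cons lp
  let Q0t : Path Cor37Vertex.ref Cor37Vertex.space := (prDeltaPath.{u} 0).cons lt
  let TPpt : Path Cor37Vertex.ref Cor37Vertex.space := ((telePath.{u} 0).cons p0).cons lt
  let L : Path Cor37Vertex.ref Cor37Vertex.space :=
    ((((Path.nil : Path Cor37Vertex.ref .ref).cons d1).cons lg).cons p0).cons lt
  -- route 1: `ι_×` behind `[δ_□]`, then `θ_{□,⋎+1}` followed by `[λ^{×pf}]`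
  have s1 : K.E PBt PBp := K.isSaturated.precomp (K.isSaturated.postcomp hTm Path.nil) deltaBoxPath.{u}
  have s2 : K.E PBp R :=
    K.isSaturated.precomp (K.isSaturated.postcomp hA1 ((Path.nil : Path Cor37Vertex.box .box).cons lp))
      Path.nil
  have r1 : K.E PBt R := K.isSaturated.trans s1 s2
  -- route 2: `θ_{□⋎}` then `[λ^×]`; telecore homotopy then `[pr_⋎]`, `[λ^×]`; `θ_⋎` whiskered; `ι_{log,⋎}`
  -- behind `[δ_{⋎+1}]`
  have s3 : K.E PBt Q0t :=
    K.isSaturated.precomp (K.isSaturated.postcomp hA0 ((Path.nil : Path Cor37Vertex.box .box).cons lt))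
      Path.nil
  have s4 : K.E Q0t TPpt :=
    K.isSaturated.precomp (K.isSaturated.postcomp hT0
      (((Path.nil : Path (Cor37Vertex.first 0) (.first 0)).cons p0).cons lt)) Path.nil
  have s5 : K.E TPpt L :=
    K.isSaturated.precomp (K.isSaturated.postcomp hG0
      (((Path.nil : Path (Cor37Vertex.first 0) (.first 0)).cons p0).cons lt))
      (((Path.nil : Path Cor37Vertex.ref .ref).cons d1).cons lg)
  have s6 : K.E L R :=
    K.isSaturated.precomp (K.isSaturated.postcomp hL0 Path.nil)
      ((Path.nil : Path Cor37Vertex.ref .ref).cons d1)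
  have t34 : K.E PBt TPpt := K.isSaturated.trans s3 s4
  have t345 : K.E PBt L := K.isSaturated.trans t34 s5
  have r2 : K.E PBt R := K.isSaturated.trans t345 s6
  -- strict components of the pinned homotopies
  have P_Tm : ∀ y : X, K.strictApp hTm y = 𝟙 _ ≫ 𝔖.iotaTimes.app y ≫ 𝟙 _ := fun y =>
    K.strictApp_pin hTm (F := 𝔖.lamTimes) (G := 𝔖.lamTimesPf) rfl rfl 𝔖.iotaTimes hhTm y
  have P_A1 : ∀ y : X, K.strictApp hA1 y = 𝟙 _ := fun y => K.strictApp_pinId hA1 hhA1 y rfl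
  have P_A0 : ∀ y : X, K.strictApp hA0 y = 𝟙 _ := fun y => K.strictApp_pinId hA0 hhA0 y rfl
  have P_T0 : ∀ y : X, K.strictApp hT0 y = 𝟙 _ := fun y => K.strictApp_pinId hT0 hhT0 y rfl
  have P_G0 : ∀ o : 𝔖.Sq, K.strictApp hG0 o = 𝟙 _ ≫ θ.thetaX.hom.app o ≫ 𝟙 _ := fun o =>
    K.strictApp_pin hG0 (F := 𝔖.proj ⋙ 𝔖.diag) (G := 𝟭 _) rfl rfl θ.thetaX.hom hhG0 o
  have P_L0 : ∀ o : 𝔖.Sq, K.strictApp hL0 o = 𝟙 _ ≫ 𝔖.iotaLogAt.app o ≫ 𝟙 _ := fun o =>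
    K.strictApp_pin hL0 (F := 𝔖.logSq ⋙ 𝔖.pr ⋙ 𝔖.lamTimes) (G := 𝔖.pr ⋙ 𝔖.lamTimesPf) rfl rfl
      𝔖.iotaLogAt (fun o e₁ e₂ => hhL0 o e₁ e₂) o
  -- strict components of the six whiskered homotopies at `x₀`
  have W1 : K.strictApp s1 x₀ = 𝟙 _ ≫ (𝟙 _ ≫ 𝔖.iotaTimes.app x₀ ≫ 𝟙 _) ≫ 𝟙 _ := by
    have := K.strictApp_whisker hTm deltaBoxPath.{u} Path.nil x₀
    rw [P_Tm] at this
    exact this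
  have W2 : K.strictApp s2 x₀ = 𝟙 _ ≫ 𝔖.lamTimesPf.map (𝟙 x₀) ≫ 𝟙 _ := by
    have := K.strictApp_whisker hA1 Path.nil ((Path.nil : Path Cor37Vertex.box .box).cons lp) x₀
    rw [P_A1] at this
    exact this
  have W3 : K.strictApp s3 x₀ = 𝟙 _ ≫ 𝔖.lamTimes.map (𝟙 x₀) ≫ 𝟙 _ := by
    have := K.strictApp_whisker hA0 Path.nil ((Path.nil : Path Cor37Vertex.box .box).cons lt) x₀
    rw [P_A0] at this
    exact this
  have W4 : K.strictApp s4 x₀ = 𝟙 _ ≫ 𝔖.lamTimes.map (𝔖.pr.map (𝟙 (𝔖.diag.obj x₀))) ≫ 𝟙 _ := by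
    have := K.strictApp_whisker hT0 Path.nil
      (((Path.nil : Path (Cor37Vertex.first 0) (.first 0)).cons p0).cons lt) x₀
    rw [P_T0] at this
    exact this
  have W5 : K.strictApp s5 x₀ = 𝟙 _ ≫
      𝔖.lamTimes.map (𝔖.pr.map (𝟙 _ ≫ θ.thetaX.hom.app (𝔖.logSq.obj (𝔖.diag.obj x₀)) ≫ 𝟙 _)) ≫
      𝟙 _ := by
    have := K.strictApp_whisker hG0 (((Path.nil : Path Cor37Vertex.ref .ref).cons d1).cons lg)
      (((Path.nil : Path (Cor37Vertex.first 0) (.first 0)).cons p0).cons lt) x₀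
    rw [P_G0] at this
    exact this
  have W6 : K.strictApp s6 x₀ = 𝟙 _ ≫ (𝟙 _ ≫ 𝔖.iotaLog.app x₀ ≫ 𝟙 _) ≫ 𝟙 _ := by
    have := K.strictApp_whisker hL0 ((Path.nil : Path Cor37Vertex.ref .ref).cons d1) Path.nil x₀
    rw [P_L0] at this
    exact this
  -- the two routes are homotopies of the same pair, hence equal
  -- (`K.strictApp r1 x₀ = K.strictApp r2 x₀` by proof irrelevance; both sides expanded by `strictApp_trans`)
  have key : K.strictApp s1 x₀ ≫ K.strictApp s2 x₀ =
      ((K.strictApp s3 x₀ ≫ K.strictApp s4 x₀) ≫ K.strictApp s5 x₀) ≫ K.strictApp s6 x₀ := by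
    rw [← K.strictApp_trans s1 s2 r1 x₀, ← K.strictApp_trans s3 s4 t34 x₀,
      ← K.strictApp_trans t34 s5 t345 x₀, ← K.strictApp_trans t345 s6 r2 x₀]
  rw [W1, W2, W3, W4, W5, W6] at key
  simp only [Category.id_comp, Category.comp_id, Functor.map_id,
    Limits.CategoricalPullback.π₁_map, FiberSquare.BiAnabelianLift.thetaX_hom_app_fst,
    Category.assoc] at key
  -- restated over the canonical objects, the remaining identities cancel
  have key' : 𝔖.iotaTimes.app x₀ ≫ 𝟙 _ = 𝟙 _ ≫
      𝔖.lamTimes.map (Limits.CategoricalPullback.Hom.fst (𝟙 (𝔖.diag.obj x₀))) ≫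
      𝔖.lamTimes.map (θ.θbi.inv.app (𝔖.logSq.obj (𝔖.diag.obj x₀))) ≫ 𝔖.iotaLog.app x₀ := key
  simp only [Category.id_comp, Category.comp_id, Functor.map_id,
    Limits.CategoricalPullback.id_fst] at key'
  -- `(θ^bi)⁻¹` at `log_𝒳(δ_𝒳 x₀)` IS `ℓ⁻¹_{x₀}` (`θbi_inv_app_logSq_diag`)
  rw [𝔖.θbi_inv_app_logSq_diag θ] at key'
  exact key'

/-! ## The exact criterion -/

/-- **A family of homotopies on `𝒟*` containing ALL the pinned homotopies of Cor 3.7 (ii)–(iv) exists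
IFF `λ^×(ℓ_A⁻¹) ≫ ι_{log,A} = ι_{×,A}` for every object `A` of `𝒳`** (⇒ `iotaTimes_eq_of_pinned`;
⇐ the lax family `starLaxFamily θ`). [cite: MochizukiAbsTopIII2015, Cor 3.7 (iv) p.88] -/
theorem exists_pinned_iff :
    (∃ K : 𝔖.starDiagram.HomotopyFamily, 𝔖.DeltaPinned θ K ∧ 𝔖.TelePinned K ∧ 𝔖.StarLogPinned K) ↔
      ∀ A : X, 𝔖.lamTimes.map (𝔖.logIsoId.inv.app A) ≫ 𝔖.iotaLog.app A = 𝔖.iotaTimes.app A := by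
  constructor
  · rintro ⟨K, hΔ, hT, hL⟩ A
    exact (𝔖.iotaTimes_eq_of_pinned θ K hΔ hT hL A).symm
  · intro hC
    refine ⟨𝔖.starLaxFamily θ, 𝔖.starLaxFamily_deltaPinned θ, 𝔖.starLaxFamily_telePinned θ,
      𝔖.starLaxFamily_starLogPinned θ fun A => ?_⟩
    rw [← hC A, ← Category.assoc, ← 𝔖.lamTimes.map_comp, Iso.hom_inv_id_app]
    erw [𝔖.lamTimes.map_id]
    exact Category.id_comp _

/-- **[AbsTopIII] Cor 3.7 (iv), second incompatibility, as typed — THE EXACT CRITERION.**  For every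
bi-anabelian setting and every lift datum `θ^bi`: "`𝔗_δ`, `ℋ_δ` and `𝔖†_log` are not simultaneously
compatible" (`TelecoreIncompatibleStmt θ`) holds IFF at some object `A` of `𝒳`,
`λ^×(ℓ_A⁻¹) ≫ ι_{log,A} ≠ ι_{×,A}`, i.e. iff `ι_×` is NOT `ι_log` transported along the given
isomorphism `ℓ : log ≅ 𝟭` of Def 3.1 (iv).  (For the MLF data of print this holds by Lemma 3.4; cf.
`TFModel.model_of_logKernelObstruction`.) [cite: MochizukiAbsTopIII2015, Cor 3.7 (iv) p.88] -/
theorem telecoreIncompatibleStmt_iff :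
    𝔖.TelecoreIncompatibleStmt θ ↔
      ∃ A : X, 𝔖.lamTimes.map (𝔖.logIsoId.inv.app A) ≫ 𝔖.iotaLog.app A ≠ 𝔖.iotaTimes.app A := by
  rw [TelecoreIncompatibleStmt, 𝔖.exists_pinned_iff θ, not_forall]

/-- The criterion as an inequality of natural transformations `λ^× ⟶ λ^{×pf}`:
`TelecoreIncompatibleStmt θ ↔ (λ^× ◃ ℓ⁻¹) ≫ ι_log ≠ ι_×`. [cite: MochizukiAbsTopIII2015, Cor 3.7 (iv) p.88] -/
theorem telecoreIncompatibleStmt_iff_ne :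
    𝔖.TelecoreIncompatibleStmt θ ↔
      Functor.whiskerRight 𝔖.logIsoId.inv 𝔖.lamTimes ≫ 𝔖.iotaLog ≠ 𝔖.iotaTimes := by
  rw [𝔖.telecoreIncompatibleStmt_iff θ]
  constructor
  · rintro ⟨A, hA⟩ h
    exact hA (NatTrans.congr_app h A)
  · intro h
    by_contra hall
    exact h (NatTrans.ext (funext fun A => not_not.mp (not_exists.mp hall A)))

/-- **The typed second incompatibility does not depend on the bi-anabelian lift datum `θ^bi`.**
[cite: MochizukiAbsTopIII2015, Cor 3.7 (iv) p.88] -/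
theorem telecoreIncompatibleStmt_iff_of_lift (θ' : FiberSquare.BiAnabelianLift 𝔖.gal) :
    𝔖.TelecoreIncompatibleStmt θ ↔ 𝔖.TelecoreIncompatibleStmt θ' := by
  rw [𝔖.telecoreIncompatibleStmt_iff θ, 𝔖.telecoreIncompatibleStmt_iff θ']

/-- **`¬ LogCoreKernel` already implies the typed second incompatibility** (for every `θ^bi`): if no
natural isomorphism `ζ : 𝟭 ⥲ log` satisfies `λ^×(ζ) ≫ ι_log = ι_×`, then in particular `ℓ⁻¹` does not
(abc-iut-L4-t9's kernel statement `LogCoreKernel` of the FIRST incompatibility).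
[cite: MochizukiAbsTopIII2015, Cor 3.7 (iv) p.88] -/
theorem telecoreIncompatibleStmt_of_not_logCoreKernel (h : ¬ 𝔖.LogCoreKernel) :
    𝔖.TelecoreIncompatibleStmt θ := by
  rw [𝔖.telecoreIncompatibleStmt_iff θ]
  by_contra hne
  exact h ⟨𝔖.logIsoId.symm, fun A => not_not.mp (not_exists.mp hne A)⟩

/-- The negation: all three structures ARE simultaneously compatible (some family on `𝒟*` contains all
the pinned homotopies) iff `ι_×` is `ι_log` transported along `ℓ`; the thin setting of
`BiAnabelianTelecoreSchemaNegative.lean` and every setting with empty `𝒳` are instances.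
[cite: MochizukiAbsTopIII2015, Cor 3.7 (iv) p.88] -/
theorem not_telecoreIncompatibleStmt_iff :
    ¬ 𝔖.TelecoreIncompatibleStmt θ ↔
      ∀ A : X, 𝔖.lamTimes.map (𝔖.logIsoId.inv.app A) ≫ 𝔖.iotaLog.app A = 𝔖.iotaTimes.app A := by
  rw [𝔖.telecoreIncompatibleStmt_iff θ, not_exists]
  exact forall_congr' fun A => not_not

/-! ## FACT-LIST instance forms (R5: named instances only) -/

/-- **INSTANCE FORM of FACT-LIST row F-0331 (`TelePinned`)**: for EVERY bi-anabelian setting and lift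
datum the lax family `starLaxFamily θ` on `𝒟*` contains the telecore homotopy
`[δ_⋎] ⇝ [δ_⋎]∘[π_⋎]∘[log_𝒳]∘[δ_{⋎+1}]` (the universal closure over all families is false:
`not_forall_telePinned`). [cite: MochizukiAbsTopIII2015, Cor 3.7 (iv) p.88] -/
theorem telePinned_holds :
    Literature.AnabelianGeometry.AbsoluteAnabelian.AbsTopIII.BiAnabelianSetting.TelePinned 𝔖
      (𝔖.starLaxFamily θ) :=
  𝔖.starLaxFamily_telePinned θ

/-- **Instance form of the schema row `DeltaPinned`** at the lax family: for every setting and `θ^bi`,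
`starLaxFamily θ` contains the generators `θ_{□⋎}`, `θ_⋎` of `ℋ_δ` (as does abc-iut-L4-t12's `ℋ_δ`
itself, `deltaFamily_pinned`). [cite: MochizukiAbsTopIII2015, Cor 3.7 (ii) p.88] -/
theorem deltaPinned_holds :
    Literature.AnabelianGeometry.AbsoluteAnabelian.AbsTopIII.BiAnabelianSetting.DeltaPinned 𝔖 θ
      (𝔖.starLaxFamily θ) :=
  𝔖.starLaxFamily_deltaPinned θ

/-- **INSTANCE FORM of FACT-LIST row F-0330 (`StarLogPinned`)**: at every setting in which `ι_×` is
`ι_log` transported along `ℓ = logIsoId` (e.g. the thin setting), the lax family contains the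
`𝔖†_log` homotopies `ι_×`, `ι_{log,⋎}` — TOGETHER with `ℋ_δ`'s generators and the telecore homotopy; at
a setting violating the identity (the MLF model, by Lemma 3.4) no family contains all of them
(`telecoreIncompatibleStmt_iff`). [cite: MochizukiAbsTopIII2015, Cor 3.7 (iv) p.88] -/
theorem starLogPinned_holds
    (hC : ∀ A : X, 𝔖.lamTimes.map (𝔖.logIsoId.inv.app A) ≫ 𝔖.iotaLog.app A = 𝔖.iotaTimes.app A) :
    Literature.AnabelianGeometry.AbsoluteAnabelian.AbsTopIII.BiAnabelianSetting.StarLogPinned 𝔖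
      (𝔖.starLaxFamily θ) :=
  𝔖.starLaxFamily_starLogPinned θ fun A => by
    rw [← hC A, ← Category.assoc, ← 𝔖.lamTimes.map_comp, Iso.hom_inv_id_app]
    erw [𝔖.lamTimes.map_id]
    exact Category.id_comp _

end AbsTopIII.BiAnabelianSetting


end Literature.AnabelianGeometry.AbsoluteAnabelian
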